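/-
Copyright (c) 2026 the pub-hodgecm-mathlib formalisation cell (harness21).  Prover seat hodgecm-mathlib-K2E5-p16 (g4): Track B «K2-LIT»,
hLiu418 = stmt-HodgeConjecture-24832, LEAD F0P6-plan (g11) LAST DEALS 2026-09-04T05:45:00Z (1) «Φ6b-1» (in force under LEAD (g12)) =
ROAD Φ organ Φ6b-1 (Shimura's `ξ` on `Herm₂(ℂ)`): INTEGRABILITY of the absolute-convergence kernel `|det(g + ix)|^{−σ}`, `σ > 3`; 2026-09-04.
-/
import Summits.HodgeConjecture.HodgeConjecture.Theorems.K2LiuHermTwoDetPowerFibres          -- ★ (this seat): key identity + scaling lemmas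
import HarnessLib

/-!
# Crux `HLiu418`, ROAD Φ, organ Φ6b-1: `∫_{Herm₂(ℂ)} |det(g + ix)|^{−σ} dx < ∞` for `g > 0` and `σ > 3 = 2κ − 1`
# (the absolute-convergence majorant of Shimura's `ξ(g, h; α, β)`, `σ = re(α + β)`)

Cell `hodgecm-mathlib`, crux item hLiu418 = `stmt-HodgeConjecture-24832`, route of record `HCCMUnconditional`; squad K2, LEAD F0P6-plan (g11 → g12)
(LAST DEALS 05:45:00Z (1) «Φ6b-1»), dealer K2E5-plan (g5) (CENSUS-41 row Φ6), prover K2E5-p16 (g4).  THEOREMS ONLY (no `def`, no instance,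
no notation, no named-fact hypothesis, no `sorry`, default heartbeats); lane `--supports stmt-HodgeConjecture-24832 --as helper` (count-neutral).

WHAT IS PROVED.  With `dx` the Lebesgue measure of the chart `x = hermTwo (a, z, b)` (★ Φ6a) and `σ : ℝ`:
* `integrable_norm_det_add_I_smul_rpow_neg {g : Matrix (Fin 2) (Fin 2) ℂ} (hg : g.PosDef) (hσ : 3 < σ) :
  Integrable (fun c => ‖(g + I • hermTwo c).det‖ ^ (-σ))` — THE MAJORANT OF `ξ` IS INTEGRABLE exactly in Shimura's range `σ > 2κ − 1 = 3`
  (chart form `integrable_norm_det_rpow_neg_hermTwo`);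
* `norm_det_add_I_smul_pos` — `det(g + ix) ≠ 0` (indeed `|det(g + ix)|² = (a²+p²)((b+μ)²+ν²) ≥ (a²+p²)ν² > 0`).

PROOF (REPORT-FIRST correction (A); no radial formula, no Plancherel, no change of variables beyond translations and scalings).  In the chart,
★ `normSq_det_eq_quadratic`: `|det(g+ix)|² = (a²+p²)((b+μ)²+ν²)`, `ν = (p‖z−(a/p)w‖² + (a²+p²)det g/p)/(a²+p²) > 0`.  FUBINI–TONELLI by
★ `integrable_prod_iff` in the order `b` (inner), `z`, `a`, the integrand being NONNEGATIVE (so every «`∫‖·‖`» is the fibre integral itself):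
(1) `∫ db = (a²+p²)^{−σ/2} ν^{1−σ} C₁`, `C₁ = ∫_ℝ (1+t²)^{−σ/2} dt` (σ > 1; ★ `integral_sq_add_sq_rpow`);
(2) `∫ dz ν^{1−σ} = (a²+p²)^{σ−1} K^{1−σ} (K/p) C₂`, `K = (a²+p²) det g/p`, `C₂ = ∫_ℂ (1+‖u‖²)^{1−σ} du` (σ > 2; ★ `integral_mul_norm_sub_sq_add_rpow`),
so `∫∫ db dz = M·(a²+p²)^{1−σ/2}` with `M = C₁C₂(det g/p)^{1−σ}(det g/p²)` (`integral_kernel_fibre_zb`);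
(3) `a ↦ (a²+p²)^{1−σ/2}` is integrable iff `σ > 3` (★ `integrable_sq_add_const_rpow`).  The constants `C₁, C₂` are never evaluated.

CONSUMER.  `K2LiuHermTwoConfluentXiConvergence.lean`: `‖ξ-integrand‖ ≤ e^{π(|im α|+|im β|)}·|det(g+ix)|^{−re(α+β)}` ⇒ absolute convergence of
Shimura's `ξ(g,h;α,β)` on `Herm₂(ℂ)` for `re(α+β) > 3` [Shimura1982, (1.26), κ = 2].
HONEST LABEL.  Count-neutral helper of the K2_Liu road; it pays no socket by itself: `HC_CM` is proved only modulo the 7 printed citations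
(2 remaining named inputs: hLiu418 = `stmt-HodgeConjecture-24832`, h413 = `stmt-HodgeConjecture-24833`) until rung 0 closes.
-/

set_option autoImplicit false
-- the mandated namespace repeats the single-problem summit's segment (`HodgeConjecture.HodgeConjecture`)
set_option linter.dupNamespace false

noncomputable section

open Complex MeasureTheory Set
open scoped ComplexOrder ComplexConjugate

namespace Summit.HodgeConjecture.HodgeConjecture.Cruxes.HLiu418.K2LiuHermTwoDetPowerIntegrable

open Summit.HodgeConjecture.HodgeConjecture.Cruxes.HLiu418.K2LiuHermTwoGammaDefs
open Summit.HodgeConjecture.HodgeConjecture.Cruxes.HLiu418.K2LiuHermTwoDetPowerFibres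

/-! ## The kernel in coordinates

`g = hermTwo (p, w, q)` (`0 < p`, `|w|² < pq`), `σ : ℝ`; the kernel `F (a, z, b) = ((a²+p²)((b + μ a z)² + (ν a z)²))^{−σ/2}` and the real
functions `μ`, `ν` are section variables with defining equations (no auxiliary `def`). -/

section Coordinates

variable {p q : ℝ} {w : ℂ} {σ : ℝ}
variable (ν : ℝ → ℂ → ℝ)
  (hν : ∀ (a : ℝ) (z : ℂ), ν a z =
    (p * ‖z - ((a / p : ℝ) : ℂ) * w‖ ^ 2 + (a ^ 2 + p ^ 2) * (p * q - normSq w) / p) / (a ^ 2 + p ^ 2))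
variable (μ : ℝ → ℂ → ℝ)
  (hμ : ∀ (a : ℝ) (z : ℂ), μ a z =
    (p * (q * a - 2 * (w * conj z).re) - a * (p * q - normSq w + normSq z)) / (a ^ 2 + p ^ 2))
variable (F : ℝ × ℂ × ℝ → ℝ)
  (hF : ∀ c : ℝ × ℂ × ℝ, F c = ((c.1 ^ 2 + p ^ 2) * ((c.2.2 + μ c.1 c.2.1) ^ 2 + (ν c.1 c.2.1) ^ 2)) ^ (-σ / 2))

include hF in
/-- The kernel is nonnegative. -/
theorem kernel_nonneg (c : ℝ × ℂ × ℝ) : 0 ≤ F c := by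
  rw [hF]
  exact Real.rpow_nonneg (mul_nonneg (by positivity) (by positivity)) _

include hν hμ hF in
/-- The kernel is measurable. -/
theorem measurable_kernel : Measurable F := by
  have hFe : F = fun c : ℝ × ℂ × ℝ => ((c.1 ^ 2 + p ^ 2) *
      ((c.2.2 + (p * (q * c.1 - 2 * (w * conj c.2.1).re) - c.1 * (p * q - normSq w + normSq c.2.1)) / (c.1 ^ 2 + p ^ 2)) ^ 2 +
        ((p * ‖c.2.1 - ((c.1 / p : ℝ) : ℂ) * w‖ ^ 2 + (c.1 ^ 2 + p ^ 2) * (p * q - normSq w) / p) / (c.1 ^ 2 + p ^ 2)) ^ 2)) ^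
          (-σ / 2) := by
    funext c
    rw [hF, hμ, hν]
  have hX : Continuous fun c : ℝ × ℂ × ℝ => c.1 ^ 2 + p ^ 2 := by fun_prop
  have h1 : Continuous fun c : ℝ × ℂ × ℝ =>
      p * (q * c.1 - 2 * (w * conj c.2.1).re) - c.1 * (p * q - normSq w + normSq c.2.1) := by fun_prop
  have h2 : Continuous fun c : ℝ × ℂ × ℝ =>
      p * ‖c.2.1 - ((c.1 / p : ℝ) : ℂ) * w‖ ^ 2 + (c.1 ^ 2 + p ^ 2) * (p * q - normSq w) / p := by fun_prop
  rw [hFe]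
  refine Measurable.pow_const (hX.measurable.mul (Measurable.add ?_ ?_)) _
  · exact (measurable_snd.snd.add (h1.measurable.div hX.measurable)).pow_const 2
  · exact (h2.measurable.div hX.measurable).pow_const 2

/-! ### Level 1: the fibre in `b` -/

include hν hF in
/-- The `b`-fibre: `∫ F db = (a²+p²)^{−σ/2} · ν^{1−σ} · C₁`. -/
theorem integral_kernel_fibre_b (hp : 0 < p) (hpq : normSq w < p * q) (a : ℝ) (z : ℂ) :
    ∫ b : ℝ, F (a, z, b) = (a ^ 2 + p ^ 2) ^ (-σ / 2) * ((ν a z) ^ (1 - σ) * ∫ t : ℝ, (1 + t ^ 2) ^ (-σ / 2)) := by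
  have hνpos : 0 < ν a z := by
    rw [hν]
    exact nu_pos hp hpq a z
  have h1 : (fun b : ℝ => F (a, z, b)) = fun b => (a ^ 2 + p ^ 2) ^ (-σ / 2) * ((b + μ a z) ^ 2 + (ν a z) ^ 2) ^ (-σ / 2) := by
    funext b
    simp only [hF]
    rw [Real.mul_rpow (by positivity) (by positivity)]
  rw [h1, integral_const_mul, integral_sq_add_sq_rpow hνpos σ (μ a z)]

include hν hF in
/-- The `b`-fibre is integrable (`σ > 1`). -/
theorem integrable_kernel_fibre_b (hp : 0 < p) (hpq : normSq w < p * q) (hσ : 1 < σ) (a : ℝ) (z : ℂ) :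
    Integrable (fun b : ℝ => F (a, z, b)) := by
  have hνpos : 0 < ν a z := by
    rw [hν]
    exact nu_pos hp hpq a z
  have h1 : (fun b : ℝ => F (a, z, b)) = fun b => (a ^ 2 + p ^ 2) ^ (-σ / 2) * ((b + μ a z) ^ 2 + (ν a z) ^ 2) ^ (-σ / 2) := by
    funext b
    simp only [hF]
    rw [Real.mul_rpow (by positivity) (by positivity)]
  rw [h1]
  exact (integrable_sq_add_sq_rpow hνpos hσ (μ a z)).const_mul _

/-! ### Level 2: the fibre in `z` -/

include hν in
/-- `ν^{1−σ} = (a²+p²)^{σ−1} · (p‖z − (a/p)w‖² + K)^{1−σ}`, `K = (a²+p²) det g/p`. -/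
theorem nu_rpow_eq (hp : 0 < p) (hpq : normSq w < p * q) (a : ℝ) (z : ℂ) :
    (ν a z) ^ (1 - σ) = (a ^ 2 + p ^ 2) ^ (σ - 1) *
      (p * ‖z - ((a / p : ℝ) : ℂ) * w‖ ^ 2 + (a ^ 2 + p ^ 2) * (p * q - normSq w) / p) ^ (1 - σ) := by
  have hX : 0 < a ^ 2 + p ^ 2 := by positivity
  have hnum : 0 ≤ p * ‖z - ((a / p : ℝ) : ℂ) * w‖ ^ 2 + (a ^ 2 + p ^ 2) * (p * q - normSq w) / p := by
    have : 0 < (a ^ 2 + p ^ 2) * (p * q - normSq w) / p := div_pos (mul_pos hX (by linarith)) hp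
    positivity
  rw [hν, Real.div_rpow hnum hX.le, div_eq_mul_inv, ← Real.rpow_neg hX.le, neg_sub, mul_comm]

include hν hF in
/-- The `(z, b)`-fibre's inner function `z ↦ ∫ F db` is integrable on `ℂ` (`σ > 2`). -/
theorem integrable_integral_kernel_fibre_b (hp : 0 < p) (hpq : normSq w < p * q) (hσ : 2 < σ) (a : ℝ) :
    Integrable (fun z : ℂ => ∫ b : ℝ, F (a, z, b)) := by
  have hK : 0 < (a ^ 2 + p ^ 2) * (p * q - normSq w) / p := div_pos (mul_pos (by positivity) (by linarith)) hp
  have h1 : (fun z : ℂ => ∫ b : ℝ, F (a, z, b)) = fun z => (a ^ 2 + p ^ 2) ^ (-σ / 2) * ((a ^ 2 + p ^ 2) ^ (σ - 1) *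
      (p * ‖z - ((a / p : ℝ) : ℂ) * w‖ ^ 2 + (a ^ 2 + p ^ 2) * (p * q - normSq w) / p) ^ (1 - σ)) *
        ∫ t : ℝ, (1 + t ^ 2) ^ (-σ / 2) := by
    funext z
    rw [integral_kernel_fibre_b ν hν μ F hF hp hpq a z, nu_rpow_eq ν hν hp hpq a z]
    ring
  rw [h1]
  exact (((integrable_mul_norm_sub_sq_add_rpow hp hK hσ _).const_mul _).const_mul _).mul_const _

include hν hF in
/-- The value of the `z`-integral of the `b`-fibre: `M · (a²+p²)^{1−σ/2}` with
`M = C₁ C₂ (det g/p)^{1−σ} (det g/p²)`. -/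
theorem integral_integral_kernel_fibre_b (hp : 0 < p) (hpq : normSq w < p * q) (a : ℝ) :
    ∫ z : ℂ, ∫ b : ℝ, F (a, z, b) =
      ((∫ t : ℝ, (1 + t ^ 2) ^ (-σ / 2)) * (∫ u : ℂ, (1 + ‖u‖ ^ 2) ^ (1 - σ)) *
          ((p * q - normSq w) / p) ^ (1 - σ) * ((p * q - normSq w) / p ^ 2)) *
        (a ^ 2 + p ^ 2) ^ (1 - σ / 2) := by
  have hX : 0 < a ^ 2 + p ^ 2 := by positivity
  have hδ : 0 < p * q - normSq w := by linarith
  have hK : 0 < (a ^ 2 + p ^ 2) * (p * q - normSq w) / p := div_pos (mul_pos hX hδ) hp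
  have h1 : (fun z : ℂ => ∫ b : ℝ, F (a, z, b)) = fun z => ((a ^ 2 + p ^ 2) ^ (-σ / 2) * (a ^ 2 + p ^ 2) ^ (σ - 1) *
      ∫ t : ℝ, (1 + t ^ 2) ^ (-σ / 2)) *
        (p * ‖z - ((a / p : ℝ) : ℂ) * w‖ ^ 2 + (a ^ 2 + p ^ 2) * (p * q - normSq w) / p) ^ (1 - σ) := by
    funext z
    rw [integral_kernel_fibre_b ν hν μ F hF hp hpq a z, nu_rpow_eq ν hν hp hpq a z]
    ring
  rw [h1, integral_const_mul, integral_mul_norm_sub_sq_add_rpow hp hK σ _]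
  -- algebra of powers of `X = a² + p²`
  have hK' : ((a ^ 2 + p ^ 2) * (p * q - normSq w) / p) ^ (1 - σ) =
      (a ^ 2 + p ^ 2) ^ (1 - σ) * ((p * q - normSq w) / p) ^ (1 - σ) := by
    rw [mul_div_assoc, Real.mul_rpow hX.le (div_pos hδ hp).le]
  rw [hK']
  have hpow : (a ^ 2 + p ^ 2) ^ (-σ / 2) * (a ^ 2 + p ^ 2) ^ (σ - 1) * (a ^ 2 + p ^ 2) ^ (1 - σ) * (a ^ 2 + p ^ 2) =
      (a ^ 2 + p ^ 2) ^ (1 - σ / 2) := by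
    conv_lhs => rw [show (a ^ 2 + p ^ 2) ^ (-σ / 2) * (a ^ 2 + p ^ 2) ^ (σ - 1) * (a ^ 2 + p ^ 2) ^ (1 - σ) * (a ^ 2 + p ^ 2) =
      (a ^ 2 + p ^ 2) ^ (-σ / 2) * (a ^ 2 + p ^ 2) ^ (σ - 1) * (a ^ 2 + p ^ 2) ^ (1 - σ) * (a ^ 2 + p ^ 2) ^ (1 : ℝ) by
        rw [Real.rpow_one]]
    rw [← Real.rpow_add hX, ← Real.rpow_add hX, ← Real.rpow_add hX]
    congr 1
    ring
  have hp0 : p ≠ 0 := hp.ne'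
  calc (a ^ 2 + p ^ 2) ^ (-σ / 2) * (a ^ 2 + p ^ 2) ^ (σ - 1) * (∫ t : ℝ, (1 + t ^ 2) ^ (-σ / 2)) *
        ((a ^ 2 + p ^ 2) ^ (1 - σ) * ((p * q - normSq w) / p) ^ (1 - σ) *
          ((a ^ 2 + p ^ 2) * (p * q - normSq w) / p / p) * ∫ u : ℂ, (1 + ‖u‖ ^ 2) ^ (1 - σ))
      = ((∫ t : ℝ, (1 + t ^ 2) ^ (-σ / 2)) * (∫ u : ℂ, (1 + ‖u‖ ^ 2) ^ (1 - σ)) *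
          ((p * q - normSq w) / p) ^ (1 - σ) * ((p * q - normSq w) / p ^ 2)) *
        ((a ^ 2 + p ^ 2) ^ (-σ / 2) * (a ^ 2 + p ^ 2) ^ (σ - 1) * (a ^ 2 + p ^ 2) ^ (1 - σ) * (a ^ 2 + p ^ 2)) := by
          field_simp
    _ = _ := by rw [hpow]

/-! ### Level 3: integrability on `ℂ × ℝ` fibres and on `ℝ × ℂ × ℝ` -/

include hν hμ hF in
/-- For every `a` the `(z, b)`-fibre of the kernel is integrable on `ℂ × ℝ` (`σ > 2`). -/
theorem integrable_kernel_fibre_zb (hp : 0 < p) (hpq : normSq w < p * q) (hσ : 2 < σ) (a : ℝ) :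
    Integrable (fun zb : ℂ × ℝ => F (a, zb)) ((volume : Measure ℂ).prod (volume : Measure ℝ)) := by
  have hm : Measurable (fun zb : ℂ × ℝ => F (a, zb)) :=
    (measurable_kernel ν hν μ hμ F hF).comp measurable_prodMk_left
  rw [integrable_prod_iff hm.aestronglyMeasurable]
  refine ⟨Filter.Eventually.of_forall fun z => integrable_kernel_fibre_b ν hν μ F hF hp hpq (by linarith) a z, ?_⟩
  have h1 : (fun z : ℂ => ∫ b : ℝ, ‖(fun zb : ℂ × ℝ => F (a, zb)) (z, b)‖) = fun z => ∫ b : ℝ, F (a, z, b) := by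
    funext z
    exact integral_congr_ae (Filter.Eventually.of_forall fun b => Real.norm_of_nonneg (kernel_nonneg ν μ F hF _))
  rw [h1]
  exact integrable_integral_kernel_fibre_b ν hν μ F hF hp hpq hσ a

include hν hμ hF in
/-- The value of the `(z, b)`-fibre: `∫∫ F dz db = M · (a²+p²)^{1−σ/2}`. -/
theorem integral_kernel_fibre_zb (hp : 0 < p) (hpq : normSq w < p * q) (hσ : 2 < σ) (a : ℝ) :
    ∫ zb : ℂ × ℝ, F (a, zb) =
      ((∫ t : ℝ, (1 + t ^ 2) ^ (-σ / 2)) * (∫ u : ℂ, (1 + ‖u‖ ^ 2) ^ (1 - σ)) *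
          ((p * q - normSq w) / p) ^ (1 - σ) * ((p * q - normSq w) / p ^ 2)) *
        (a ^ 2 + p ^ 2) ^ (1 - σ / 2) := by
  rw [Measure.volume_eq_prod, integral_prod _ (integrable_kernel_fibre_zb ν hν μ hμ F hF hp hpq hσ a)]
  exact integral_integral_kernel_fibre_b ν hν μ F hF hp hpq a

include hν hμ hF in
/-- INTEGRABILITY OF THE KERNEL on `ℝ × ℂ × ℝ` for `σ > 3`. -/
theorem integrable_kernel (hp : 0 < p) (hpq : normSq w < p * q) (hσ : 3 < σ) :
    Integrable F (volume : Measure (ℝ × ℂ × ℝ)) := by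
  rw [Measure.volume_eq_prod, integrable_prod_iff (measurable_kernel ν hν μ hμ F hF).aestronglyMeasurable]
  refine ⟨Filter.Eventually.of_forall fun a => integrable_kernel_fibre_zb ν hν μ hμ F hF hp hpq (by linarith) a, ?_⟩
  have h1 : (fun a : ℝ => ∫ zb : ℂ × ℝ, ‖F (a, zb)‖) = fun a =>
      ((∫ t : ℝ, (1 + t ^ 2) ^ (-σ / 2)) * (∫ u : ℂ, (1 + ‖u‖ ^ 2) ^ (1 - σ)) *
          ((p * q - normSq w) / p) ^ (1 - σ) * ((p * q - normSq w) / p ^ 2)) *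
        (a ^ 2 + p ^ 2) ^ (1 - σ / 2) := by
    funext a
    rw [← integral_kernel_fibre_zb ν hν μ hμ F hF hp hpq (by linarith) a]
    exact integral_congr_ae (Filter.Eventually.of_forall fun zb => Real.norm_of_nonneg (kernel_nonneg ν μ F hF _))
  rw [h1]
  exact (integrable_sq_add_const_rpow hp hσ).const_mul _

end Coordinates

/-! ## The heads -/

/-- **THE MAJORANT OF `ξ` IS INTEGRABLE, chart form**: for `g = hermTwo (p, w, q)` with `0 < p`, `|w|² < pq` and `σ > 3`,
`x ↦ |det(g + ix)|^{−σ}` is integrable on `Herm₂(ℂ) ≅ ℝ × ℂ × ℝ`. -/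
theorem integrable_norm_det_rpow_neg_hermTwo (d : ℝ × ℂ × ℝ) (hd : 0 < d.1 ∧ normSq d.2.1 < d.1 * d.2.2)
    {σ : ℝ} (hσ : 3 < σ) :
    Integrable (fun c : ℝ × ℂ × ℝ => ‖(hermTwo d + I • hermTwo c).det‖ ^ (-σ)) := by
  obtain ⟨p, w, q⟩ := d
  have hp : 0 < p := hd.1
  have hpq : normSq w < p * q := hd.2
  have h := integrable_kernel (p := p) (q := q) (w := w) (σ := σ)
    (fun a z => (p * ‖z - ((a / p : ℝ) : ℂ) * w‖ ^ 2 + (a ^ 2 + p ^ 2) * (p * q - normSq w) / p) / (a ^ 2 + p ^ 2))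
    (fun _ _ => rfl)
    (fun a z => (p * (q * a - 2 * (w * conj z).re) - a * (p * q - normSq w + normSq z)) / (a ^ 2 + p ^ 2))
    (fun _ _ => rfl)
    (fun c => ((c.1 ^ 2 + p ^ 2) *
      ((c.2.2 + (p * (q * c.1 - 2 * (w * conj c.2.1).re) - c.1 * (p * q - normSq w + normSq c.2.1)) / (c.1 ^ 2 + p ^ 2)) ^ 2 +
        ((p * ‖c.2.1 - ((c.1 / p : ℝ) : ℂ) * w‖ ^ 2 + (c.1 ^ 2 + p ^ 2) * (p * q - normSq w) / p) / (c.1 ^ 2 + p ^ 2)) ^ 2)) ^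
          (-σ / 2))
    (fun _ => rfl) hp hpq hσ
  refine h.congr (Filter.Eventually.of_forall fun c => ?_)
  obtain ⟨a, z, b⟩ := c
  exact (norm_det_rpow_neg_eq hp σ a z b).symm

/-- On the tube, `det(g + ix) ≠ 0`: indeed `‖det(g + ix)‖ > 0` (chart form; `|det|² ≥ (a²+p²)ν² > 0`). -/
theorem norm_det_add_I_smul_pos_hermTwo (d : ℝ × ℂ × ℝ) (hd : 0 < d.1 ∧ normSq d.2.1 < d.1 * d.2.2) (c : ℝ × ℂ × ℝ) :
    0 < ‖(hermTwo d + I • hermTwo c).det‖ := by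
  obtain ⟨p, w, q⟩ := d
  obtain ⟨a, z, b⟩ := c
  have hp : 0 < p := hd.1
  have hpq : normSq w < p * q := hd.2
  have hνpos := nu_pos (q := q) hp hpq a z
  have hsq : 0 < ‖(hermTwo (p, w, q) + I • hermTwo (a, z, b)).det‖ ^ 2 := by
    rw [Complex.sq_norm, normSq_det_eq_quadratic hp a z b]
    exact mul_pos (by positivity) (by positivity)
  exact (norm_nonneg _).lt_of_ne (fun h => by rw [← h] at hsq; simp at hsq)

/-- **THE MAJORANT OF SHIMURA'S `ξ` IS INTEGRABLE** (organ Φ6b-1, absolute convergence; [Shimura1982, (1.26), Case II, m = κ = 2]): for a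
positive definite Hermitian `2 × 2` matrix `g` and `σ > 3 = 2κ − 1`, `x ↦ |det(g + ix)|^{−σ}` is integrable on `Herm₂(ℂ)` (Lebesgue measure of the
chart `ℝ × ℂ × ℝ`).  The abscissa is sharp (`∫ (a²+p²)^{1−σ/2} da` diverges for `σ ≤ 3`). -/
theorem integrable_norm_det_add_I_smul_rpow_neg {g : Matrix (Fin 2) (Fin 2) ℂ} (hg : g.PosDef) {σ : ℝ} (hσ : 3 < σ) :
    Integrable (fun c : ℝ × ℂ × ℝ => ‖(g + I • hermTwo c).det‖ ^ (-σ)) := by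
  have hg' : hermTwo ((g 0 0).re, g 0 1, (g 1 1).re) = g := hermTwo_eq_of_isHermitian hg.1
  have hd := (posDef_hermTwo_iff ((g 0 0).re, g 0 1, (g 1 1).re)).mp (hg'.symm ▸ hg)
  rw [← hg']
  exact integrable_norm_det_rpow_neg_hermTwo _ hd hσ

/-- For `g` positive definite and `x` Hermitian (chart), `det(g + ix) ≠ 0` — quantitatively `0 < ‖det(g + ix)‖`. -/
theorem norm_det_add_I_smul_pos {g : Matrix (Fin 2) (Fin 2) ℂ} (hg : g.PosDef) (c : ℝ × ℂ × ℝ) :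
    0 < ‖(g + I • hermTwo c).det‖ := by
  have hg' : hermTwo ((g 0 0).re, g 0 1, (g 1 1).re) = g := hermTwo_eq_of_isHermitian hg.1
  have hd := (posDef_hermTwo_iff ((g 0 0).re, g 0 1, (g 1 1).re)).mp (hg'.symm ▸ hg)
  rw [← hg']
  exact norm_det_add_I_smul_pos_hermTwo _ hd c

/-- `det(g − ix) = conj det(g + ix)` for `g` positive definite (so `|det(g − ix)| = |det(g + ix)|`). -/
theorem det_sub_I_smul_eq_conj {g : Matrix (Fin 2) (Fin 2) ℂ} (hg : g.PosDef) (c : ℝ × ℂ × ℝ) :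
    (g - I • hermTwo c).det = conj ((g + I • hermTwo c).det) := by
  have hg' : hermTwo ((g 0 0).re, g 0 1, (g 1 1).re) = g := hermTwo_eq_of_isHermitian hg.1
  rw [← hg']
  exact det_hermTwo_sub_I_smul_hermTwo _ c

end Summit.HodgeConjecture.HodgeConjecture.Cruxes.HLiu418.K2LiuHermTwoDetPowerIntegrable

end
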